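import Literature.Analysis.FluidPDE.BackwardHeatInteriorGradient
import Literature.Analysis.FluidPDE.BackwardHeatCaccioppoli
import HarnessLib

/-!
# Unique continuation across spatial boundaries, II: the space–time cut-off of Lemma A.1

Analysis/FluidPDE support file (everything proved, no definitions) on the discharge path of the
named fact `Literature.Analysis.FluidPDE.ess_unique_continuation` (`NSLerayHopfProofs.lean`;
Escauriaza–Seregin–Šverák 2003, Thm. 4.1 = Seregin 2014, App. A.2, Thm. 2.4 / Lemma A.1).
In the proof of Lemma A.1 (Seregin 2014, pp. 210–211) the rescaled function `v` on
`Q(ρ, 2) = B(ρ) × ]0, 2[` is multiplied by two cut-offs, `φ` (equal to `1` on `Q(ρ-1, 3/2)`,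
vanishing off `B(ρ) × ]-2, 2[`) and `φ_ε(s)` (vanishing for `s < ε`, equal to `1` for
`s > 2ε`), and the first Carleman inequality is applied to `w_ε = φ_ε φ v`; the error terms are
controlled through (A.2.7): `|∂ₛw_ε + Δw_ε| ≤ c₁λ(|w_ε| + |∇w_ε|) + c (|∇φ||∇v| + (|∇φ| + |Δφ| +
|∂ₛφ|)|v|) + c |φ_ε'||v|`. This file supplies, in the uncurried frame calculus of
`CarlemanCalculus.lean` (time first, `z = (s, y)`):

* `exists_ucCutoff` — **the cut-off** `η = η_{ρ,ε}` (`ρ ≥ 1`, `0 < ε ≤ 1`): `η ∈ C²_c(ℝ × E)`,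
  `tsupport η ⊆ [ε, 7/4] × B̄(0, ρ)`, `η = 1` on `]2ε, 3/2[ × B(0, ρ/2)`, with the bounds
  `|∇η|² ≤ C`, `|Δη| ≤ C`, `|∂ₛη| ≤ C/ε` everywhere, `|∂ₛη| ≤ C` on `{s ≥ 2ε}`, and `∇η = 0` on
  `{|y| < ρ/2}`, the constant `C` depending only on `E` (we cut off at `|y| ∈ [ρ/2, ρ]` and
  `s ∈ [3/2, 7/4]` rather than `|y| ∈ [ρ-1, ρ]`, `s ∈ [3/2, 2[`; `η(s, y) = φ_ε(s) χ(s) ζ(y)`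
  with `φ_ε(s) = S((s-ε)/ε)`, `S` the smooth transition, `χ`, `ζ` the cut-offs of
  `BackwardHeatInteriorGradient.lean`);
* `sq_mul_gradSq_div_two_sub_le` — `|∇(ηv)|² ≥ η²|∇v|²/2 - |∇η|²|v|²`;
* `norm_sq_dt_add_lap_cutoff_smul_le` — (A.2.7) squared: if `|∂ₛv + Δv| ≤ c(|v| + |∇v|)` at
  `z`, then `|∂ₛ(ηv) + Δ(ηv)|² ≤ 4c²η²(|v|² + |∇v|²) + 4|∂ₛη + Δη|²|v|² + 16|∇η|²|∇v|²`.

## References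

* G. Seregin, *Lecture notes on regularity theory for the Navier–Stokes equations*, World
  Scientific 2014, App. A.2, proof of Lemma A.1, (A.2.7)–(A.2.10), pp. 210–211.
* L. Escauriaza, G. Seregin, V. Šverák, Russ. Math. Surveys 58:2 (2003), §4, proof of
  Lemma 4.2.
-/

noncomputable section

open Set Function Filter Topology Metric
open scoped InnerProductSpace RealInnerProductSpace

namespace Literature.Analysis.FluidPDE

namespace Carleman

/-! ### The cut-off `η_{ρ,ε}(s, y) = φ_ε(s) χ(s) ζ(y)` -/

section Cutoff

variable {E : Type*} [NormedAddCommGroup E] [InnerProductSpace ℝ E] [FiniteDimensional ℝ E]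

/-- **The initial-layer cut-off `φ_ε`.** There is `D ≥ 0` such that for every `ε > 0` there is
a smooth `φ : ℝ → [0, 1]` with `φ = 0` on `(-∞, ε]`, `φ = 1` on `[2ε, ∞)`, `|φ'| ≤ D/ε`
everywhere and `φ' = 0` on `[2ε, ∞)` (`φ(s) = S((s - ε)/ε)`, `S` the smooth transition;
Seregin 2014, proof of Lemma A.1, the function `φ_ε`). [cite: Seregin2014, App. A.2, proof of Lemma A.1] -/
theorem exists_layer_cutoff : ∃ D : ℝ, 0 ≤ D ∧ ∀ ε : ℝ, 0 < ε →
    ∃ φ : ℝ → ℝ, ContDiff ℝ 2 φ ∧ (∀ s, 0 ≤ φ s ∧ φ s ≤ 1) ∧ (∀ s, s ≤ ε → φ s = 0) ∧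
      (∀ s, 2 * ε ≤ s → φ s = 1) ∧ (∀ s, |deriv φ s| ≤ D / ε) ∧
      ∀ s, 2 * ε ≤ s → deriv φ s = 0 := by
  obtain ⟨D, hD0, hD⟩ := Calculus.exists_bound_deriv_smoothTransition
  refine ⟨D, hD0, fun ε hε => ?_⟩
  have hℓ : ∀ s, HasDerivAt (fun s : ℝ => (s - ε) / ε) (1 / ε) s := fun s => by
    simpa using ((hasDerivAt_id s).sub_const ε).div_const ε
  have hφ : ∀ s, HasDerivAt (fun s : ℝ => Real.smoothTransition ((s - ε) / ε))
      (deriv Real.smoothTransition ((s - ε) / ε) * (1 / ε)) s := fun s =>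
    (Calculus.differentiable_smoothTransition _).hasDerivAt.comp s (hℓ s)
  have h2ε : ∀ s, 2 * ε ≤ s → 1 ≤ (s - ε) / ε := fun s hs => by
    rw [le_div_iff₀ hε]; linarith
  refine ⟨fun s => Real.smoothTransition ((s - ε) / ε), ?_, fun s =>
    ⟨Real.smoothTransition.nonneg _, Real.smoothTransition.le_one _⟩, fun s hs => ?_,
    fun s hs => ?_, fun s => ?_, fun s hs => ?_⟩
  · exact Real.smoothTransition.contDiff.comp ((contDiff_id.sub contDiff_const).div_const _)
  · exact Real.smoothTransition.zero_of_nonpos (div_nonpos_of_nonpos_of_nonneg (by linarith) hε.le)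
  · exact Real.smoothTransition.one_of_one_le (h2ε s hs)
  · rw [(hφ s).deriv, abs_mul, abs_of_pos (by positivity : (0 : ℝ) < 1 / ε)]
    calc |deriv Real.smoothTransition ((s - ε) / ε)| * (1 / ε) ≤ D * (1 / ε) :=
          mul_le_mul_of_nonneg_right (hD _) (by positivity)
      _ = D / ε := by ring
  · rw [(hφ s).deriv, Calculus.deriv_smoothTransition_of_one_le (h2ε s hs), zero_mul]

/-- **The cut-off of Lemma A.1.** There is `C ≥ 1`, depending only on `E`, such that for all
`ρ ≥ 1` and `0 < ε ≤ 1` there is `η : ℝ × E → ℝ` of class `C²` with compact support,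
`tsupport η ⊆ [ε, 7/4] × B̄(0, ρ)`, `η = 1` on `]2ε, 3/2[ × B(0, ρ/2)`, and
`|∇η|² ≤ C`, `|Δη| ≤ C`, `|∂ₛη| ≤ C/ε` everywhere, `|∂ₛη| ≤ C` on `{s ≥ 2ε}`, `|∇η|² = 0` on
`{|y| < ρ/2}` (`η = φ_ε(s) χ(s) ζ(y)`: Seregin 2014, proof of Lemma A.1, the product
`φ_ε φ`, with the transition regions `|y| ∈ [ρ/2, ρ]`, `s ∈ [3/2, 7/4]`). [cite: Seregin2014, App. A.2, proof of Lemma A.1] -/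
theorem exists_ucCutoff : ∃ C : ℝ, 1 ≤ C ∧ ∀ (ρ ε : ℝ), 1 ≤ ρ → 0 < ε → ε ≤ 1 →
    ∃ η : ℝ × E → ℝ, ContDiff ℝ 2 η ∧ HasCompactSupport η ∧
      tsupport η ⊆ Icc ε (7 / 4) ×ˢ closedBall (0 : E) ρ ∧
      EqOn η (fun _ => 1) (Ioo (2 * ε) (3 / 2) ×ˢ ball (0 : E) (ρ / 2)) ∧
      (∀ z, gradSq η z ≤ C ∧ |lap η z| ≤ C ∧ |dt η z| ≤ C / ε) ∧
      (∀ z : ℝ × E, 2 * ε ≤ z.1 → |dt η z| ≤ C) ∧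
      (∀ z : ℝ × E, ‖z.2‖ < ρ / 2 → gradSq η z = 0) := by
  obtain ⟨D, hD0, hφ⟩ := exists_layer_cutoff
  obtain ⟨Ct, hCt0, hχ⟩ := exists_time_cutoff
  obtain ⟨Cs, hCs0, hζ⟩ := exists_space_cutoff (E := E)
  set n : ℕ := Module.finrank ℝ E with hn
  set b := stdOrthonormalBasis ℝ E with hb
  set C : ℝ := 1 + n * Cs ^ 2 + n * Cs + D + Ct with hC
  have hn0 : (0 : ℝ) ≤ n := Nat.cast_nonneg _
  have hC1 : 1 ≤ C := by rw [hC]; nlinarith [sq_nonneg Cs]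
  have hC0 : 0 ≤ C := zero_le_one.trans hC1
  refine ⟨C, hC1, fun ρ ε hρ hε hε1 => ?_⟩
  have hρ0 : 0 < ρ := by linarith
  obtain ⟨φ, hφs, hφ01, hφ0, hφ1, hφd, hφd0⟩ := hφ ε hε
  obtain ⟨χ, hχs, hχ1, hχ0, hχb, hχd⟩ := hχ (5 / 4) 1 one_pos
  obtain ⟨ζ, hζs, hζ1, hζ0, hζb, hζd1, hζd2⟩ := hζ 0 ρ hρ0
  -- the time factor `pT = φ χ` and the cut-off `η`
  set pT : ℝ → ℝ := fun s => φ s * χ s with hpT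
  have hpTs : ContDiff ℝ 2 pT := hφs.mul hχs
  have hpTd : Differentiable ℝ pT := hpTs.differentiable (by norm_num)
  have hφdiff : Differentiable ℝ φ := hφs.differentiable (by norm_num)
  have hχdiff : Differentiable ℝ χ := hχs.differentiable (by norm_num)
  have hζdiff : Differentiable ℝ ζ := hζs.differentiable (by norm_num)
  have hζ' : ∀ e, Differentiable ℝ fun y => fderiv ℝ ζ y e := fun e =>
    ((hζs.fderiv_right (m := 1) le_rfl).differentiable one_ne_zero).clm_apply
      (differentiable_const e)
  have hderiv_pT : ∀ s, deriv pT s = deriv φ s * χ s + φ s * deriv χ s := fun s => by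
    rw [hpT, deriv_fun_mul (hφdiff s) (hχdiff s)]
  set η : ℝ × E → ℝ := fun z => pT z.1 * ζ z.2 with hη
  -- derivative formulas
  have hdt : ∀ z, dt η z = deriv pT z.1 * ζ z.2 := fun z => by
    rw [dt_apply, hη, show z = (z.1, z.2) from rfl, fderiv_mul_fst_snd_apply hpTd hζdiff]
    simp
  have hdx : ∀ e z, dx e η z = pT z.1 * fderiv ℝ ζ z.2 e := fun e z => by
    rw [dx_apply, hη, show z = (z.1, z.2) from rfl, fderiv_mul_fst_snd_apply hpTd hζdiff]
    simp
  have hdxdx : ∀ e z, dx e (dx e η) z = pT z.1 * fderiv ℝ (fun y => fderiv ℝ ζ y e) z.2 e := by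
    intro e z
    have hfun : dx e η = fun z : ℝ × E => pT z.1 * (fun y => fderiv ℝ ζ y e) z.2 :=
      funext fun z => hdx e z
    rw [dx_apply, hfun, show z = (z.1, z.2) from rfl, fderiv_mul_fst_snd_apply hpTd (hζ' e)]
    simp
  have hgradSq : ∀ z, gradSq η z = pT z.1 ^ 2 * ∑ i, (fderiv ℝ ζ z.2 (b i)) ^ 2 := fun z => by
    simp only [gradSq, hdx, Real.norm_eq_abs, sq_abs, mul_pow, Finset.mul_sum, hb]
  have hlap : ∀ z, lap η z = pT z.1 * ∑ i, fderiv ℝ (fun y => fderiv ℝ ζ y (b i)) z.2 (b i) :=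
    fun z => by simp only [lap, hdxdx, Finset.mul_sum, hb]
  -- bounds on the factors
  have hpT1 : ∀ s, |pT s| ≤ 1 := fun s => by
    rw [hpT, abs_mul]
    exact mul_le_one₀ (by rw [abs_of_nonneg (hφ01 s).1]; exact (hφ01 s).2) (abs_nonneg _) (hχb s)
  have hpT2 : ∀ s, pT s ^ 2 ≤ 1 := fun s => by
    have h := hpT1 s
    rw [abs_le] at h
    nlinarith
  have hζd1' : ∀ y (e : E), |fderiv ℝ ζ y e| ≤ Cs * ‖e‖ := fun y e => by
    refine (hζd1 y e).trans (mul_le_mul_of_nonneg_right ?_ (norm_nonneg _))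
    exact div_le_self hCs0 hρ
  have hζd2' : ∀ y (e : E), |fderiv ℝ (fun y => fderiv ℝ ζ y e) y e| ≤ Cs * ‖e‖ ^ 2 := by
    intro y e
    refine (hζd2 y e).trans (mul_le_mul_of_nonneg_right ?_ (by positivity))
    exact div_le_self hCs0 (by nlinarith)
  have hsum1 : ∀ y, ∑ i, (fderiv ℝ ζ y (b i)) ^ 2 ≤ n * Cs ^ 2 := fun y => by
    calc ∑ i, (fderiv ℝ ζ y (b i)) ^ 2 ≤ ∑ _i : Fin (Module.finrank ℝ E), Cs ^ 2 :=
          Finset.sum_le_sum fun i _ => by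
            have h := hζd1' y (b i)
            rw [b.orthonormal.1 i, mul_one] at h
            rw [← sq_abs]
            exact pow_le_pow_left₀ (abs_nonneg _) h 2
      _ = n * Cs ^ 2 := by simp [hn]
  have hsum2 : ∀ y, |∑ i, fderiv ℝ (fun y => fderiv ℝ ζ y (b i)) y (b i)| ≤ n * Cs := fun y => by
    calc |∑ i, fderiv ℝ (fun y => fderiv ℝ ζ y (b i)) y (b i)|
        ≤ ∑ i, |fderiv ℝ (fun y => fderiv ℝ ζ y (b i)) y (b i)| := Finset.abs_sum_le_sum_abs _ _
      _ ≤ ∑ _i : Fin (Module.finrank ℝ E), Cs := Finset.sum_le_sum fun i _ => by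
          have h := hζd2' y (b i)
          rwa [b.orthonormal.1 i, one_pow, mul_one] at h
      _ = n * Cs := by simp [hn]
  have hderiv_bound : ∀ s, |deriv pT s| ≤ (D + Ct) / ε := fun s => by
    rw [hderiv_pT]
    have h1 : |deriv φ s * χ s| ≤ D / ε := by
      rw [abs_mul]
      calc |deriv φ s| * |χ s| ≤ D / ε * 1 :=
            mul_le_mul (hφd s) (hχb s) (abs_nonneg _) (by positivity)
        _ = D / ε := mul_one _
    have h2 : |φ s * deriv χ s| ≤ Ct / ε := by
      rw [abs_mul]
      calc |φ s| * |deriv χ s| ≤ 1 * (Ct / 1 ^ 2) :=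
            mul_le_mul (by rw [abs_of_nonneg (hφ01 s).1]; exact (hφ01 s).2) (hχd s)
              (abs_nonneg _) zero_le_one
        _ = Ct := by ring
        _ ≤ Ct / ε := le_div_self hCt0 hε hε1
    calc |deriv φ s * χ s + φ s * deriv χ s| ≤ |deriv φ s * χ s| + |φ s * deriv χ s| :=
          abs_add_le _ _
      _ ≤ D / ε + Ct / ε := add_le_add h1 h2
      _ = (D + Ct) / ε := by ring
  have hderiv_bound' : ∀ s, 2 * ε ≤ s → |deriv pT s| ≤ Ct := fun s hs => by
    rw [hderiv_pT, hφd0 s hs, zero_mul, zero_add, abs_mul]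
    calc |φ s| * |deriv χ s| ≤ 1 * (Ct / 1 ^ 2) :=
          mul_le_mul (by rw [abs_of_nonneg (hφ01 s).1]; exact (hφ01 s).2) (hχd s)
            (abs_nonneg _) zero_le_one
      _ = Ct := by ring
  -- support
  set K : Set (ℝ × E) := Icc ε (7 / 4) ×ˢ closedBall (0 : E) ρ with hK
  have hKc : IsCompact K := isCompact_Icc.prod (isCompact_closedBall _ _)
  have hsupp : support η ⊆ K := by
    intro z hz
    rw [mem_support] at hz
    have h1 : pT z.1 ≠ 0 := left_ne_zero_of_mul hz
    have h2 : ζ z.2 ≠ 0 := right_ne_zero_of_mul hz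
    have h3 : φ z.1 ≠ 0 := left_ne_zero_of_mul h1
    have h4 : χ z.1 ≠ 0 := right_ne_zero_of_mul h1
    refine ⟨⟨?_, ?_⟩, ?_⟩
    · by_contra h
      exact h3 (hφ0 _ (le_of_lt (not_le.1 h)))
    · by_contra h
      exact h4 (hχ0 _ (by linarith [not_le.1 h]))
    · rw [mem_closedBall, dist_zero_right]
      by_contra h
      exact h2 (hζ0 _ (by rw [sub_zero]; exact le_of_lt (not_le.1 h)))
  have htsupp : tsupport η ⊆ K := closure_minimal hsupp hKc.isClosed
  refine ⟨η, (hpTs.comp contDiff_fst).mul (hζs.comp contDiff_snd),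
    IsCompact.of_isClosed_subset hKc (isClosed_tsupport _) htsupp, htsupp, ?_, ?_, ?_, ?_⟩
  · -- `η = 1` on the inner box
    intro z hz
    have h1 : φ z.1 = 1 := hφ1 _ hz.1.1.le
    have h2 : χ z.1 = 1 := hχ1 _ (by norm_num; linarith [hz.1.2])
    have h3 : ζ z.2 = 1 := hζ1 _ (by
      rw [sub_zero]
      have := hz.2
      rw [mem_ball, dist_zero_right] at this
      exact this.le)
    show pT z.1 * ζ z.2 = 1
    rw [hpT]
    simp only [h1, h2, h3, mul_one]
  · -- global bounds
    intro z
    refine ⟨?_, ?_, ?_⟩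
    · rw [hgradSq]
      calc pT z.1 ^ 2 * ∑ i, (fderiv ℝ ζ z.2 (b i)) ^ 2 ≤ 1 * (n * Cs ^ 2) :=
            mul_le_mul (hpT2 _) (hsum1 _) (Finset.sum_nonneg fun i _ => sq_nonneg _) zero_le_one
        _ ≤ C := by rw [hC, one_mul]; nlinarith
    · rw [hlap, abs_mul]
      calc |pT z.1| * |∑ i, fderiv ℝ (fun y => fderiv ℝ ζ y (b i)) z.2 (b i)| ≤ 1 * (n * Cs) :=
            mul_le_mul (hpT1 _) (hsum2 _) (abs_nonneg _) zero_le_one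
        _ ≤ C := by rw [hC, one_mul]; nlinarith [sq_nonneg Cs]
    · rw [hdt, abs_mul]
      calc |deriv pT z.1| * |ζ z.2| ≤ (D + Ct) / ε * 1 :=
            mul_le_mul (hderiv_bound _) (hζb _) (abs_nonneg _) (by positivity)
        _ ≤ C / ε := by
            rw [mul_one]
            exact div_le_div_of_nonneg_right (by rw [hC]; nlinarith [sq_nonneg Cs]) hε.le
  · -- `|∂ₛη| ≤ C` for `s ≥ 2ε`
    intro z hz
    rw [hdt, abs_mul]
    calc |deriv pT z.1| * |ζ z.2| ≤ Ct * 1 :=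
          mul_le_mul (hderiv_bound' _ hz) (hζb _) (abs_nonneg _) hCt0
      _ ≤ C := by rw [hC, mul_one]; nlinarith [sq_nonneg Cs]
  · -- `∇η = 0` inside `B(0, ρ/2)`
    intro z hz
    have hev : ζ =ᶠ[𝓝 z.2] fun _ => 1 := by
      filter_upwards [Metric.isOpen_ball.mem_nhds (show z.2 ∈ ball (0 : E) (ρ / 2) by
        rwa [mem_ball, dist_zero_right])] with y hy
      rw [mem_ball, dist_zero_right] at hy
      exact hζ1 _ (by rw [sub_zero]; exact hy.le)
    have hfd : fderiv ℝ ζ z.2 = 0 := by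
      rw [hev.fderiv_eq]; exact fderiv_const_apply _
    rw [hgradSq]
    simp [hfd]

end Cutoff

/-! ### Pointwise inequalities for cut-off products -/

section Pointwise

variable {E : Type*} [NormedAddCommGroup E] [InnerProductSpace ℝ E] [FiniteDimensional ℝ E]
variable {F : Type*} [NormedAddCommGroup F] [InnerProductSpace ℝ F]
variable {U : Set (ℝ × E)} {Φ : ℝ × E → ℝ} {u : ℝ × E → F}

/-- **`|∇(Φu)|² ≥ Φ²|∇u|²/2 - |∇Φ|²|u|²`** (from `∂ᵢ(Φu) = Φ∂ᵢu + (∂ᵢΦ)u` and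
`‖a + b‖² ≥ ‖a‖²/2 - ‖b‖²`). [folklore] -/
theorem sq_mul_gradSq_div_two_sub_le (hU : IsOpen U) (hΦ : ContDiff ℝ 1 Φ)
    (hΦU : tsupport Φ ⊆ U) (hu : DifferentiableOn ℝ u U) (z : ℝ × E) :
    Φ z ^ 2 * gradSq u z / 2 - gradSq Φ z * ‖u z‖ ^ 2 ≤ gradSq (fun y => Φ y • u y) z := by
  set b := stdOrthonormalBasis ℝ E with hb
  rw [gradSq_cutoff_smul hU hΦ hΦU hu z]
  have key : ∀ i, Φ z ^ 2 * ‖dx (b i) u z‖ ^ 2 / 2 - ‖dx (b i) Φ z‖ ^ 2 * ‖u z‖ ^ 2 ≤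
      ‖Φ z • dx (b i) u z + dx (b i) Φ z • u z‖ ^ 2 := by
    intro i
    have h := half_sq_norm_sub_sq_norm_le (Φ z • dx (b i) u z) (dx (b i) Φ z • u z)
    rw [norm_smul, norm_smul, Real.norm_eq_abs, mul_pow, mul_pow, sq_abs] at h
    simpa [Real.norm_eq_abs, sq_abs] using h
  calc Φ z ^ 2 * gradSq u z / 2 - gradSq Φ z * ‖u z‖ ^ 2
      = ∑ i, (Φ z ^ 2 * ‖dx (b i) u z‖ ^ 2 / 2 - ‖dx (b i) Φ z‖ ^ 2 * ‖u z‖ ^ 2) := by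
        rw [Finset.sum_sub_distrib, gradSq, gradSq, Finset.mul_sum, Finset.sum_div, Finset.sum_mul]
    _ ≤ ∑ i, ‖Φ z • dx (b i) u z + dx (b i) Φ z • u z‖ ^ 2 := Finset.sum_le_sum fun i _ => key i

/-- **Cauchy–Schwarz for the cross term**: `‖Σᵢ ∂ᵢΦ ∂ᵢu‖² ≤ |∇Φ|² |∇u|²`. [folklore] -/
theorem norm_sum_dx_smul_dx_sq_le (z : ℝ × E) :
    ‖∑ i, dx (stdOrthonormalBasis ℝ E i) Φ z • dx (stdOrthonormalBasis ℝ E i) u z‖ ^ 2 ≤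
      gradSq Φ z * gradSq u z := by
  set b := stdOrthonormalBasis ℝ E with hb
  have h1 : ‖∑ i, dx (b i) Φ z • dx (b i) u z‖ ≤ ∑ i, |dx (b i) Φ z| * ‖dx (b i) u z‖ :=
    (norm_sum_le _ _).trans (le_of_eq (Finset.sum_congr rfl fun i _ => by
      rw [norm_smul, Real.norm_eq_abs]))
  have h2 : ∑ i, |dx (b i) Φ z| * ‖dx (b i) u z‖ ≤
      Real.sqrt (∑ i, |dx (b i) Φ z| ^ 2) * Real.sqrt (∑ i, ‖dx (b i) u z‖ ^ 2) :=
    Real.sum_mul_le_sqrt_mul_sqrt _ _ _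
  have h3 : ∑ i, |dx (b i) Φ z| ^ 2 = gradSq Φ z := by
    simp only [gradSq, Real.norm_eq_abs, hb]
  have h4 : ∑ i, ‖dx (b i) u z‖ ^ 2 = gradSq u z := rfl
  rw [h3, h4] at h2
  have h5 : 0 ≤ ∑ i, |dx (b i) Φ z| * ‖dx (b i) u z‖ :=
    Finset.sum_nonneg fun i _ => mul_nonneg (abs_nonneg _) (norm_nonneg _)
  have hg1 : 0 ≤ gradSq Φ z := gradSq_nonneg _ _
  have hg2 : 0 ≤ gradSq u z := gradSq_nonneg _ _
  calc ‖∑ i, dx (b i) Φ z • dx (b i) u z‖ ^ 2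
      ≤ (Real.sqrt (gradSq Φ z) * Real.sqrt (gradSq u z)) ^ 2 :=
        pow_le_pow_left₀ (norm_nonneg _) (h1.trans h2) 2
    _ = gradSq Φ z * gradSq u z := by
        rw [mul_pow, Real.sq_sqrt hg1, Real.sq_sqrt hg2]

/-- **(A.2.7) squared** (Seregin 2014, proof of Lemma A.1): if `u ∈ C²(U)`, `Φ ∈ C²`,
`z ∈ U` and `|∂ₛu + Δu| ≤ c(|u| + |∇u|)` at `z` (`c ≥ 0`), then
`|∂ₛ(Φu) + Δ(Φu)|²(z) ≤ 4c²Φ²(|u|² + |∇u|²) + 4|∂ₛΦ + ΔΦ|²|u|² + 16|∇Φ|²|∇u|²`. [cite: Seregin2014, App. A.2 (A.2.7)] -/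
theorem norm_sq_dt_add_lap_cutoff_smul_le (hU : IsOpen U) (hΦ : ContDiff ℝ 2 Φ)
    (hu : ContDiffOn ℝ 2 u U) {z : ℝ × E} (hz : z ∈ U) {c : ℝ} (hc : 0 ≤ c)
    (hineq : ‖dt u z + lap u z‖ ≤ c * (‖u z‖ + Real.sqrt (gradSq u z))) :
    ‖dt (fun y => Φ y • u y) z + lap (fun y => Φ y • u y) z‖ ^ 2 ≤
      4 * c ^ 2 * Φ z ^ 2 * (‖u z‖ ^ 2 + gradSq u z) + 4 * (dt Φ z + lap Φ z) ^ 2 * ‖u z‖ ^ 2 +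
        16 * (gradSq Φ z * gradSq u z) := by
  set b := stdOrthonormalBasis ℝ E with hb
  rw [dt_add_lap_smul_apply hU hΦ hu hz]
  set A : F := Φ z • (dt u z + lap u z) with hA
  set B : F := (dt Φ z + lap Φ z) • u z with hB
  set S : F := ∑ i, dx (b i) Φ z • dx (b i) u z with hS
  have hg : 0 ≤ gradSq u z := gradSq_nonneg _ _
  have hsq : Real.sqrt (gradSq u z) ^ 2 = gradSq u z := Real.sq_sqrt hg
  -- the three pieces
  have hA2 : ‖A‖ ^ 2 ≤ 2 * c ^ 2 * Φ z ^ 2 * (‖u z‖ ^ 2 + gradSq u z) := by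
    have h1 : ‖A‖ = |Φ z| * ‖dt u z + lap u z‖ := by rw [hA, norm_smul, Real.norm_eq_abs]
    have h2 : ‖A‖ ≤ |Φ z| * (c * (‖u z‖ + Real.sqrt (gradSq u z))) := by
      rw [h1]; exact mul_le_mul_of_nonneg_left hineq (abs_nonneg _)
    have h3 : 0 ≤ |Φ z| * (c * (‖u z‖ + Real.sqrt (gradSq u z))) := by positivity
    have h4 := pow_le_pow_left₀ (norm_nonneg _) h2 2
    have h5 : (‖u z‖ + Real.sqrt (gradSq u z)) ^ 2 ≤ 2 * (‖u z‖ ^ 2 + gradSq u z) := by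
      nlinarith [sq_nonneg (‖u z‖ - Real.sqrt (gradSq u z))]
    calc ‖A‖ ^ 2 ≤ (|Φ z| * (c * (‖u z‖ + Real.sqrt (gradSq u z)))) ^ 2 := h4
      _ = c ^ 2 * Φ z ^ 2 * (‖u z‖ + Real.sqrt (gradSq u z)) ^ 2 := by
          rw [mul_pow, mul_pow, sq_abs]; ring
      _ ≤ c ^ 2 * Φ z ^ 2 * (2 * (‖u z‖ ^ 2 + gradSq u z)) := by gcongr
      _ = 2 * c ^ 2 * Φ z ^ 2 * (‖u z‖ ^ 2 + gradSq u z) := by ring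
  have hB2 : ‖B‖ ^ 2 = (dt Φ z + lap Φ z) ^ 2 * ‖u z‖ ^ 2 := by
    rw [hB, norm_smul, Real.norm_eq_abs, mul_pow, sq_abs]
  have hS2 : ‖(2 : ℝ) • S‖ ^ 2 ≤ 4 * (gradSq Φ z * gradSq u z) := by
    rw [norm_smul, mul_pow, Real.norm_eq_abs, abs_of_pos two_pos]
    have h := norm_sum_dx_smul_dx_sq_le (Φ := Φ) (u := u) z
    norm_num
    linarith
  -- `‖A + B + 2S‖² ≤ 2‖A‖² + 4‖B‖² + 4‖2S‖²`
  have htri : ‖A + B + (2 : ℝ) • S‖ ^ 2 ≤ 2 * ‖A‖ ^ 2 + 4 * ‖B‖ ^ 2 + 4 * ‖(2 : ℝ) • S‖ ^ 2 := by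
    have h1 : ‖A + B + (2 : ℝ) • S‖ ≤ ‖A‖ + ‖B‖ + ‖(2 : ℝ) • S‖ := norm_add₃_le
    have h2 := pow_le_pow_left₀ (norm_nonneg _) h1 2
    nlinarith [sq_nonneg (‖A‖ - ‖B‖ - ‖(2 : ℝ) • S‖), sq_nonneg (‖B‖ - ‖(2 : ℝ) • S‖),
      norm_nonneg A, norm_nonneg B, norm_nonneg ((2 : ℝ) • S)]
  calc ‖A + B + (2 : ℝ) • S‖ ^ 2 ≤ 2 * ‖A‖ ^ 2 + 4 * ‖B‖ ^ 2 + 4 * ‖(2 : ℝ) • S‖ ^ 2 := htri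
    _ ≤ 2 * (2 * c ^ 2 * Φ z ^ 2 * (‖u z‖ ^ 2 + gradSq u z)) +
          4 * ((dt Φ z + lap Φ z) ^ 2 * ‖u z‖ ^ 2) + 4 * (4 * (gradSq Φ z * gradSq u z)) := by
        rw [hB2]; gcongr
    _ = _ := by ring

end Pointwise

end Carleman

end Literature.Analysis.FluidPDE
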